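import Summits.KontsevichZagierPeriods.KontsevichZagierPeriods.Theorems.EffectiveXMapChains.Negative.PeriodRep

/-!
# `XMapKernel`, line `isogeny-orbit-collapse` — stub **S**: the real-period sector representations exist

Support file for the crux `IsogenyCertificates.XMapKernel` (stmt-KontsevichZagierPeriods-10663), line
`isogeny-orbit-collapse`, stub `stub_sectorRepsExist`.

For every nonsingular integral short Weierstrass cubic `P = x³ + Ax + B` (`4A³ + 27B² ≠ 0`) and every
`a : ℚ`, the pair `[{P > 0}, a/√P]` is an honest Kontsevich–Zagier integral representation in
dimension `1` (`KZ.IntegralRep 1`): the domain `{P > 0} ⊆ ℝ¹` is `ℚ`-semialgebraic, the integrand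
`a/√P` is a `ℚ`-semialgebraic function on it, and `a/√P` is integrable on `{P > 0}` — the
convergence of the real-period integral of the elliptic curve `y² = P(x)`: for the short model
`W = ⟨0, 0, 0, A, B⟩`, `ψ = 4x³ + 4Ax + 4B = 4P`, `{ψ > 0} = {P > 0}`, `Δ = −16 (4A³ + 27B²) ≠ 0`,
and the tree's `WeierstrassCurve.integrableOn_inv_sqrt_twoTorsionPolynomial'` gives integrability of
`(√ψ)⁻¹` on `{ψ > 0}`, transported `ℝ → (Fin 1 → ℝ)` along `MeasurableEquiv.funUnique`.

All of this is already assembled in the tree as the structure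
`EffectiveXMapChainsNegative.periodRep A B a h : KZ.IntegralRep 1`
(`Theorems/EffectiveXMapChains/Negative/PeriodRep.lean`, whose `domain`/`integrand` fields are the
literal set and function of the stub), so the stub is the existence statement it witnesses.
No new definitions; no named facts are used.
-/

noncomputable section

namespace Summit.KontsevichZagierPeriods.IsogenyCertificates.XMapKernelStubs.SectorRepsExist

open Literature.NumberTheory.Transcendental
open Summit.KontsevichZagierPeriods.IsogenyCertificates.EffectiveXMapChainsNegative

/-- **S — the sector representations exist.** For every nonsingular integral short Weierstrass
cubic `P = x³ + Ax + B` (`4A³ + 27B² ≠ 0`) and every `a : ℚ` there is a `KZ.IntegralRep 1` with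
domain `{x | P(x 0) > 0}` and integrand `x ↦ a/√P(x 0)` (literally): the witness is the tree's
`periodRep A B a h` (domain `ℚ`-semialgebraic, integrand a `ℚ`-semialgebraic function on it,
integrable by the convergence of the real-period integral `∫_{ψ>0} dx/√ψ`, `ψ = 4P`, of
`y² = P(x)` — `WeierstrassCurve.integrableOn_inv_sqrt_twoTorsionPolynomial'`).
[cite: KontsevichZagier2001, §1.1] -/
theorem stub_sectorRepsExist : ∀ (A B : ℤ) (a : ℚ), 4 * A ^ 3 + 27 * B ^ 2 ≠ 0 → ∃ r : Literature.NumberTheory.Transcendental.KZ.IntegralRep 1, r.domain = {x | 0 < x 0 ^ 3 + (A : ℝ) * x 0 + (B : ℝ)} ∧ r.integrand = fun x => (a : ℝ) / Real.sqrt (x 0 ^ 3 + (A : ℝ) * x 0 + (B : ℝ)) :=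
  fun A B a h => ⟨periodRep A B a h, rfl, rfl⟩

end Summit.KontsevichZagierPeriods.IsogenyCertificates.XMapKernelStubs.SectorRepsExist
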